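import Summits.QuantumFields.YangMills.Theorems.BalabanUVNodesRateCarriersOfRecord13
import Literature.MathematicalPhysics.QuantumFieldTheory.Balaban1983to89.T4BetaReadOutLipschitz

/-!
# BalabanUVNodes ∕ N27 = binder B5 — THE (D4) READ-OUT BINDER `YMDAG.UVSplit.ReadOutAt D u` PRODUCED IN THE «KERNEL-SLICE ∕ (5.10)–(5.42)» CURRENCY: the recipe IS print's
# (1.22) second moment `B12Beta.secondMoment` of a polarisation KERNEL READ OFF THE SLICE at a `ℤᵈ`-indexed family of scale-`(k+1)` carrier domains, and the two UNPRINTED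
# read-out binders `ReadBoundedOn` ∕ `ReadCovariantOn` are DISCHARGED by the tree's (5.10) ⇒ (5.42) Lipschitz lemma `T4BetaReadOutLipschitz.secondMoment_sub_abs_le` at
# `cr = betaPrime510 d 1 κ = Σ_{x ∈ ℤᵈ} |x|₁² e^{−κ|x|₁}`

Cell `pub-ymgap` (HUMAN RULING D-0062 Track A; director-ym №197 ∕ HUMAN RULING D-0149), width seat `pub-ymgap-dag-n27-w1` (gen 0) on NODE n27 (B5 composite); the constructive
follow-up to this seat's LOCATED caveat on its probes-currency producer `…N27ReadOutAtOfProbes` (p584096): a FINITE probe recipe (`T4BetaReadOutLipschitz` §3) is by its own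
header a truncation of [I] (1.20)–(1.22), while def-B's β of record is, on the box, `betaMerged … k v = B12Beta.secondMoment (polLimit …) 0 1` (`Node00/BetaOfRecord`) — the FULL
(1.22) lattice second moment of a limiting kernel.  In the currency below the slice of the run-A functional STORES a kernel `z ↦ Π_{k+1}(g; z)` at dedicated carrier points
`(bg k μ ν z, dom k μ ν z)` and the recipe is LITERALLY `secondMoment` of that kernel, so `RepresentsA` reads «β_{k+1}(v) = Σ_z Π_{k+1}(extd v; z) z_μ z_ν» — print's (1.22) —
and holds ON THE NOSE for a U3 reading storing the limiting (1.21) kernel; the domination constant is the (5.42) majorant.  Filed `--kind proof --supports stmt-QuantumFields-20544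
--as helper` (K3⁷ `SpineGivenEndpointR13SepCoPH`); COUNT-NEUTRAL.  [I] = [Balaban1987RG1].

WHAT IS KERNEL-CHECKED (theorems only; 0 `def`, 0 `sorry`; the data are PLAIN ARGUMENTS — lattice dimension `dd`, directions `μ₀ ν₀`, carrier points `dom k μ ν z` of scale
`k + 1` with tree length `≥ |z|₁`, background labels `bg k μ ν z`; the kernel read off a slice `F` is `fun μ ν z => F (bg k μ ν z) (dom k μ ν z)`).
* §1 `decay510_sub_of_sliceClose` — weighted sup-closeness of two slices on the scale-`(k+1)` slice (`SliceClose κ k F G M`) ⟹ the DIFFERENCE of the kernels read off them obeys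
  (5.10) `Decay510 _ M κ` (tree length `≥ |z|₁`, `0 ≤ κ`); `decay510_sub_of_transportClose` — the same with run A read through `C.transport`.
* §2 ★ `readBoundedOn_kernelSlice` — `ReadBoundedOn 𝒜 r κ cr` for the second-moment recipe on the class `𝒜` of slices whose step-`k` kernels obey (5.10) at rate `κ` (absolute
  convergence of (1.22), `B12Sec2to5.secondMoment_abs_le_of_decay510`), every `cr ≥ betaPrime510 dd 1 κ`, `0 < κ` — by `secondMoment_sub_abs_le`; ★ `readCovariantOn_kernelSlice` —
  the pairing convention with run A's labels the transports of run B's.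
* §4 `representsA_betaOfMerged_of_stores_polLimit` ∕ `representsB_…` — FAITHFULNESS: for def-B's `betaOfMerged (betaMerged F ℰ ρ bV) β0 γ` (`Node00/BetaOfRecord`, the shape of
  `betaOfRecord₈…₁₃` on the box) `RepresentsA∕B` HOLD BY CONSTRUCTION (pure unfolding, `betaOfMerged_of_mem`) for any functional that STORES the limiting (1.21) kernel
  `polLimit F (k+1) (ℰ k v ·) ρ bV` at the carrier points along the box histories — the displayed storage clause is what a (D4)-faithful U3 reading must satisfy.
* §3 ★★ `readOutAt_of_kernelSlices` — (D4) `ReadOutAt D u` from: `0 < u.κ`, `betaPrime510 dd 1 u.κ ≤ u.cr`, the box clause, `RepresentsA u.EA rA u.γ D.βfun` ∕ `RepresentsB u.EB rB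
  u.γ D.βfun` IN THIS CURRENCY, the two class memberships on the window, and the four remaining letter signs; `readOutAt_u3OfRecord₁₃_of_kernelSlices` — at node U3's bundle of
  record `u3OfRecord₁₃ θ uo k` (box clause FREE by `T4BetaReadOut.extd_mem_window`, signs `uo.Signs`, plus `0 < uo.κ`).

HONEST FRAMING.  [bookkeeping ∕ folklore]: packaging of the tree's (5.10)∕(5.42) lemma; NO estimate of Bałaban's is proved or asserted — the (5.10) decay of the stored kernels
([I] (5.10) p. 293, located in print, derived there «from the representation (4.37)»), the representation clauses ((1.21)–(1.22) p. 264 for the LIMITING kernel — an existence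
statement of print) and `0 < κ` are HYPOTHESES, inhabited here for no family; nothing instantiated at the record's W1 reading (whose level functionals are finite-volume terms —
what a (D4)-faithful U3 reading must store is exactly the displayed data); N17 ∕ N27 NOT discharged; K3⁷ OPEN, NOT claimed; route rev 25 and the skeleton of record UNTOUCHED;
counts UNMOVED (typed 28∕28 · discharged 5∕27, A 5∕28); one finite four-torus programme at fixed `ε` — R4 closes the conditional rung `BalabanLadder.UV` only: NOT ℝ⁴, NOT infinite
volume, NOT OS, NOT a mass gap, NOT Clay.  No decl below carries a cite tag.
-/

namespace Summit.QuantumFields.YangMills.BalabanUVNodes.N27ReadOutAtOfKernelSlices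

open Literature.MathematicalPhysics.QuantumFieldTheory.Balaban1983to89
open Literature.MathematicalPhysics.QuantumFieldTheory.Balaban1983to89.T4Continuum
open Literature.MathematicalPhysics.QuantumFieldTheory.Balaban1983to89.T4OutputRate (Carriers Functional Window)
open Literature.MathematicalPhysics.QuantumFieldTheory.Balaban1983to89.T4BetaReadOut (Slice ReadOut SliceClose RepresentsA RepresentsB extd_mem_window)
open Literature.MathematicalPhysics.QuantumFieldTheory.Balaban1983to89.T4BetaReadOutLipschitz (ReadBoundedOn ReadCovariantOn secondMoment_sub_abs_le)
open Literature.MathematicalPhysics.QuantumFieldTheory.Balaban1983to89.B12Sec2to5 (l1 l1_nonneg Decay510 betaPrime510)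
open Literature.MathematicalPhysics.QuantumFieldTheory.Balaban1983to89.T4FlagMemory (extd)
open Literature.MathematicalPhysics.QuantumFieldTheory.Balaban1983to89.FlowStep (Box)
open YMDAG.UVSplit
open Node00 (Stage13Params U3Objects₁₁)

variable {F : T4Family} {N : ℕ} [NeZero N]

/-! ## §1 Closeness of slices ⟹ (5.10) for the difference of the kernels read off them -/

section Kernels

variable {C : Carriers} {Bg : Type} {dd : ℕ}

/-- **SLICE-CLOSE ⟹ (5.10) FOR THE DIFFERENCE KERNEL**: if two slices are `M·e^{−κ d(X)}`-close on the scale-`(k+1)` slice and the carrier points `dom k μ ν z` have scale `k + 1`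
and tree length `≥ |z|₁`, then the kernels read off them at `(μ, ν)` differ by a `Decay510 _ M κ` kernel (`0 ≤ κ`). [folklore] -/
theorem decay510_sub_of_sliceClose (dom : ℕ → Fin dd → Fin dd → (Fin dd → ℤ) → C.Dom) (bg : ℕ → Fin dd → Fin dd → (Fin dd → ℤ) → Bg)
    (hsc : ∀ k μ ν z, C.scale (dom k μ ν z) = k + 1) (hd : ∀ k μ ν z, l1 z ≤ C.d (dom k μ ν z)) {κ : ℝ} (hκ : 0 ≤ κ)
    {k : ℕ} {F G : Slice C Bg} {M : ℝ} (hFG : SliceClose κ k F G M) (μ ν : Fin dd) :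
    Decay510 (fun z => F (bg k μ ν z) (dom k μ ν z) - G (bg k μ ν z) (dom k μ ν z)) M κ := by
  intro z
  have h := hFG (bg k μ ν z) (dom k μ ν z) (hsc k μ ν z)
  have hM : 0 ≤ M := nonneg_of_mul_nonneg_left ((abs_nonneg _).trans h) (Real.exp_pos _)
  refine h.trans (mul_le_mul_of_nonneg_left (Real.exp_le_exp.mpr ?_) hM)
  have := mul_le_mul_of_nonneg_left (hd k μ ν z) hκ
  linarith

/-- **RUN A THROUGH THE TRANSPORT**: if a run-A slice `F` seen through `C.transport` and a run-B slice `G` are `M·e^{−κ d(X)}`-close on the scale-`(k+1)` slice, the kernel read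
off `F` at the transported labels and the kernel read off `G` differ by a `Decay510 _ M κ` kernel. [folklore] -/
theorem decay510_sub_of_transportClose (dom : ℕ → Fin dd → Fin dd → (Fin dd → ℤ) → C.Dom) (bgB : ℕ → Fin dd → Fin dd → (Fin dd → ℤ) → C.BgB)
    (hsc : ∀ k μ ν z, C.scale (dom k μ ν z) = k + 1) (hd : ∀ k μ ν z, l1 z ≤ C.d (dom k μ ν z)) {κ : ℝ} (hκ : 0 ≤ κ)
    {k : ℕ} {F : Slice C C.BgA} {G : Slice C C.BgB} {M : ℝ}
    (hFG : ∀ (U : C.BgB) (X : C.Dom), C.scale X = k + 1 → |F (C.transport U) X - G U X| ≤ M * Real.exp (-(κ * C.d X))) (μ ν : Fin dd) :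
    Decay510 (fun z => F (C.transport (bgB k μ ν z)) (dom k μ ν z) - G (bgB k μ ν z) (dom k μ ν z)) M κ := by
  intro z
  have h := hFG (bgB k μ ν z) (dom k μ ν z) (hsc k μ ν z)
  have hM : 0 ≤ M := nonneg_of_mul_nonneg_left ((abs_nonneg _).trans h) (Real.exp_pos _)
  refine h.trans (mul_le_mul_of_nonneg_left (Real.exp_le_exp.mpr ?_) hM)
  have := mul_le_mul_of_nonneg_left (hd k μ ν z) hκ
  linarith

/-- `betaPrime510 dd M κ = betaPrime510 dd 1 κ * M` (the (5.42) majorant is linear in its constant). [folklore] -/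
theorem betaPrime510_eq_one_mul (M κ : ℝ) : betaPrime510 dd M κ = betaPrime510 dd 1 κ * M := by
  unfold betaPrime510
  ring

end Kernels

/-! ## §2 The second-moment recipe: `ReadBoundedOn` ∕ `ReadCovariantOn` DISCHARGED by (5.10) ⇒ (5.42) -/

section Recipe

variable {C : Carriers} {Bg : Type} {dd : ℕ}

/-- ★ **(R) DISCHARGED FOR THE SECOND-MOMENT RECIPE (kernel).**  On the class of slices whose step-`k` kernels at `(μ₀, ν₀)` obey (5.10) at rate `κ > 0` (absolute convergence of
(1.22)), the recipe `F ↦ Σ_z Π_F(z) z_{μ₀} z_{ν₀}` is `cr`-dominated by the weighted sup-closeness on the scale-`(k+1)` slice for every `cr ≥ betaPrime510 dd 1 κ = Σ_x |x|₁² e^{−κ|x|₁}`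
— `secondMoment_sub_abs_le` on the DIFFERENCE kernel of §1.  The (5.10) decay of the class members is a HYPOTHESIS (membership), located in print at [I] (5.10) p. 293. [bookkeeping] -/
theorem readBoundedOn_kernelSlice (μ₀ ν₀ : Fin dd) (dom : ℕ → Fin dd → Fin dd → (Fin dd → ℤ) → C.Dom) (bg : ℕ → Fin dd → Fin dd → (Fin dd → ℤ) → Bg)
    (hsc : ∀ k μ ν z, C.scale (dom k μ ν z) = k + 1) (hd : ∀ k μ ν z, l1 z ≤ C.d (dom k μ ν z)) {κ cr : ℝ} (hκ : 0 < κ) (hcr : betaPrime510 dd 1 κ ≤ cr) :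
    ReadBoundedOn {F : Slice C Bg | ∃ C₀ : ℝ, ∀ k, Decay510 (fun z => F (bg k μ₀ ν₀ z) (dom k μ₀ ν₀ z)) C₀ κ}
      (fun k F => B12Beta.secondMoment (fun μ ν z => F (bg k μ ν z) (dom k μ ν z)) μ₀ ν₀) κ cr := by
  intro k F G M hF hG hFG
  obtain ⟨C₀, hC₀⟩ := hF
  obtain ⟨C₀', hC₀'⟩ := hG
  have hM : 0 ≤ M := by
    have h := hFG (bg k μ₀ ν₀ 0) (dom k μ₀ ν₀ 0) (hsc k μ₀ ν₀ 0)
    exact nonneg_of_mul_nonneg_left ((abs_nonneg _).trans h) (Real.exp_pos _)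
  have hD := decay510_sub_of_sliceClose dom bg hsc hd hκ.le hFG μ₀ ν₀
  have h := secondMoment_sub_abs_le (Pk := fun μ ν z => F (bg k μ ν z) (dom k μ ν z)) (Pk' := fun μ ν z => G (bg k μ ν z) (dom k μ ν z))
    (μ := μ₀) (ν := ν₀) hκ (hC₀ k) (hC₀' k) hD
  calc |B12Beta.secondMoment (fun μ ν z => F (bg k μ ν z) (dom k μ ν z)) μ₀ ν₀ -
        B12Beta.secondMoment (fun μ ν z => G (bg k μ ν z) (dom k μ ν z)) μ₀ ν₀|
      ≤ betaPrime510 dd M κ := h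
    _ = betaPrime510 dd 1 κ * M := betaPrime510_eq_one_mul M κ
    _ ≤ cr * M := mul_le_mul_of_nonneg_right hcr hM

/-- ★ **THE PAIRING CONVENTION DISCHARGED FOR THE SECOND-MOMENT RECIPE (kernel).**  Run A reads its kernel at the TRANSPORTED labels `C.transport (bgB k μ ν z)`, run B at
`bgB k μ ν z`, same carrier points; on the two (5.10)-classes the pairing convention holds with the same `cr ≥ betaPrime510 dd 1 κ`.  What stays a CONVENTION is that run A's probe
backgrounds ARE the transports of run B's (the status of `Carriers.transport`). [bookkeeping] -/
theorem readCovariantOn_kernelSlice (μ₀ ν₀ : Fin dd) (dom : ℕ → Fin dd → Fin dd → (Fin dd → ℤ) → C.Dom) (bgB : ℕ → Fin dd → Fin dd → (Fin dd → ℤ) → C.BgB)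
    (hsc : ∀ k μ ν z, C.scale (dom k μ ν z) = k + 1) (hd : ∀ k μ ν z, l1 z ≤ C.d (dom k μ ν z)) {κ cr : ℝ} (hκ : 0 < κ) (hcr : betaPrime510 dd 1 κ ≤ cr) :
    ReadCovariantOn {F : Slice C C.BgA | ∃ C₀ : ℝ, ∀ k, Decay510 (fun z => F (C.transport (bgB k μ₀ ν₀ z)) (dom k μ₀ ν₀ z)) C₀ κ}
      {G : Slice C C.BgB | ∃ C₀ : ℝ, ∀ k, Decay510 (fun z => G (bgB k μ₀ ν₀ z) (dom k μ₀ ν₀ z)) C₀ κ}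
      (fun k F => B12Beta.secondMoment (fun μ ν z => F (C.transport (bgB k μ ν z)) (dom k μ ν z)) μ₀ ν₀)
      (fun k G => B12Beta.secondMoment (fun μ ν z => G (bgB k μ ν z) (dom k μ ν z)) μ₀ ν₀) κ cr := by
  intro k F G M hF hG hFG
  obtain ⟨C₀, hC₀⟩ := hF
  obtain ⟨C₀', hC₀'⟩ := hG
  have hM : 0 ≤ M := by
    have h := hFG (bgB k μ₀ ν₀ 0) (dom k μ₀ ν₀ 0) (hsc k μ₀ ν₀ 0)
    exact nonneg_of_mul_nonneg_left ((abs_nonneg _).trans h) (Real.exp_pos _)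
  have hD := decay510_sub_of_transportClose dom bgB hsc hd hκ.le hFG μ₀ ν₀
  have h := secondMoment_sub_abs_le (Pk := fun μ ν z => F (C.transport (bgB k μ ν z)) (dom k μ ν z)) (Pk' := fun μ ν z => G (bgB k μ ν z) (dom k μ ν z))
    (μ := μ₀) (ν := ν₀) hκ (hC₀ k) (hC₀' k) hD
  calc |B12Beta.secondMoment (fun μ ν z => F (C.transport (bgB k μ ν z)) (dom k μ ν z)) μ₀ ν₀ -
        B12Beta.secondMoment (fun μ ν z => G (bgB k μ ν z) (dom k μ ν z)) μ₀ ν₀|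
      ≤ betaPrime510 dd M κ := h
    _ = betaPrime510 dd 1 κ * M := betaPrime510_eq_one_mul M κ
    _ ≤ cr * M := mul_le_mul_of_nonneg_right hcr hM

end Recipe

/-! ## §3 (D4) produced in the kernel-slice currency -/

section Produce

variable {dd : ℕ}

/-- ★★ **(D4) `ReadOutAt D u` PRODUCED IN THE KERNEL-SLICE CURRENCY.**  Data: directions `μ₀ ν₀`, carrier points `dom` (scale `k + 1`, tree length `≥ |z|₁`), run-B labels `bgB`
(run A through `u.C.transport`).  Hypotheses: `0 < u.κ`; `betaPrime510 dd 1 u.κ ≤ u.cr`; the box clause; `RepresentsA` ∕ `RepresentsB` IN THIS CURRENCY — the datum's β-function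
IS the (1.22) second moment of the kernel the run-A functional (resp. run B's re-indexed family) stores at the carrier points; the (5.10) class memberships on the window; four
letter signs.  The witnesses are the two (5.10)-classes and the two second-moment recipes; `ReadBoundedOn` ∕ `ReadCovariantOn` are §2.  NOT a discharge of (D4) at any datum of
record. [bookkeeping] -/
theorem readOutAt_of_kernelSlices (D : Datum F N) (u : U3Carriers) (μ₀ ν₀ : Fin dd)
    (dom : ℕ → Fin dd → Fin dd → (Fin dd → ℤ) → u.C.Dom) (bgB : ℕ → Fin dd → Fin dd → (Fin dd → ℤ) → u.C.BgB)
    (hsc : ∀ k μ ν z, u.C.scale (dom k μ ν z) = k + 1) (hd : ∀ k μ ν z, l1 z ≤ u.C.d (dom k μ ν z))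
    (hκ : 0 < u.κ) (hcr : betaPrime510 dd 1 u.κ ≤ u.cr)
    (hW : ∀ k (v : Fin (k + 1) → ℝ), v ∈ Box u.γ k → extd v ∈ u.W)
    (hA : RepresentsA u.EA (fun k F => B12Beta.secondMoment (fun μ ν z => F (u.C.transport (bgB k μ ν z)) (dom k μ ν z)) μ₀ ν₀) u.γ D.βfun)
    (hB : RepresentsB u.EB (fun k G => B12Beta.secondMoment (fun μ ν z => G (bgB k μ ν z) (dom k μ ν z)) μ₀ ν₀) u.γ D.βfun)
    (hdecA : ∀ g ∈ u.W, ∃ C₀ : ℝ, ∀ k, Decay510 (fun z => u.EA g (u.C.transport (bgB k μ₀ ν₀ z)) (dom k μ₀ ν₀ z)) C₀ u.κ)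
    (hdecB : ∀ b : ℝ, 0 < b → b ≤ u.γ → ∀ g ∈ u.W, ∃ C₀ : ℝ, ∀ k, Decay510 (fun z => u.EB b g (bgB k μ₀ ν₀ z) (dom k μ₀ ν₀ z)) C₀ u.κ)
    (hC₅ : 0 ≤ u.C₅) (hθ : 0 ≤ u.θ) (hω : 0 ≤ u.ω) (hθρ : u.θ ≤ u.ρ) (hωρ : u.ω ≤ u.ρ) :
    ReadOutAt D u := by
  have hcr0 : 0 ≤ u.cr := by
    refine le_trans ?_ hcr
    unfold betaPrime510
    exact mul_nonneg zero_le_one (tsum_nonneg fun x => mul_nonneg (sq_nonneg _) (Real.exp_pos _).le)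
  exact ⟨{F' : Slice u.C u.C.BgA | ∃ C₀ : ℝ, ∀ k, Decay510 (fun z => F' (u.C.transport (bgB k μ₀ ν₀ z)) (dom k μ₀ ν₀ z)) C₀ u.κ},
    {G : Slice u.C u.C.BgB | ∃ C₀ : ℝ, ∀ k, Decay510 (fun z => G (bgB k μ₀ ν₀ z) (dom k μ₀ ν₀ z)) C₀ u.κ},
    fun k F' => B12Beta.secondMoment (fun μ ν z => F' (u.C.transport (bgB k μ ν z)) (dom k μ ν z)) μ₀ ν₀,
    fun k G => B12Beta.secondMoment (fun μ ν z => G (bgB k μ ν z) (dom k μ ν z)) μ₀ ν₀,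
    hW, hA, hB, hdecA, hdecB,
    readBoundedOn_kernelSlice μ₀ ν₀ dom (fun k μ ν z => u.C.transport (bgB k μ ν z)) hsc hd hκ hcr,
    readCovariantOn_kernelSlice μ₀ ν₀ dom bgB hsc hd hκ hcr, hcr0, hC₅, hθ, hω, hθρ, hωρ⟩

/-- **(D4) IN THE KERNEL-SLICE CURRENCY AT NODE U3's BUNDLE OF RECORD** `u3OfRecord₁₃ θ uo k` (any datum `D`): the box clause is FREE (`extd_mem_window`), the signs are `uo.Signs`;
displayed stay `0 < uo.κ`, `betaPrime510 dd 1 uo.κ ≤ uo.cr`, the two representation clauses and the two (5.10) memberships for the level-`k` functionals.  NOT a discharge.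
[bookkeeping] -/
theorem readOutAt_u3OfRecord₁₃_of_kernelSlices (θ : Stage13Params F N) (uo : U3Objects₁₁) (hs : uo.Signs) (k : ℕ) (D : Datum F N) (μ₀ ν₀ : Fin dd)
    (dom : ℕ → Fin dd → Fin dd → (Fin dd → ℤ) → (uo.levelCarriers k).Dom) (bgB : ℕ → Fin dd → Fin dd → (Fin dd → ℤ) → (uo.levelCarriers k).BgB)
    (hsc : ∀ j μ ν z, (uo.levelCarriers k).scale (dom j μ ν z) = j + 1) (hd : ∀ j μ ν z, l1 z ≤ (uo.levelCarriers k).d (dom j μ ν z))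
    (hκ : 0 < uo.κ) (hcr : betaPrime510 dd 1 uo.κ ≤ uo.cr)
    (hA : RepresentsA (uo.EA k) (fun j F' => B12Beta.secondMoment (fun μ ν z => F' ((uo.levelCarriers k).transport (bgB j μ ν z)) (dom j μ ν z)) μ₀ ν₀) θ.γ D.βfun)
    (hB : RepresentsB (uo.EB k) (fun j G => B12Beta.secondMoment (fun μ ν z => G (bgB j μ ν z) (dom j μ ν z)) μ₀ ν₀) θ.γ D.βfun)
    (hdecA : ∀ g ∈ Window θ.γ, ∃ C₀ : ℝ, ∀ j, Decay510 (fun z => uo.EA k g ((uo.levelCarriers k).transport (bgB j μ₀ ν₀ z)) (dom j μ₀ ν₀ z)) C₀ uo.κ)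
    (hdecB : ∀ b : ℝ, 0 < b → b ≤ θ.γ → ∀ g ∈ Window θ.γ, ∃ C₀ : ℝ, ∀ j, Decay510 (fun z => uo.EB k b g (bgB j μ₀ ν₀ z) (dom j μ₀ ν₀ z)) C₀ uo.κ) :
    ReadOutAt D (u3OfRecord₁₃ θ uo k) :=
  readOutAt_of_kernelSlices D (u3OfRecord₁₃ θ uo k) μ₀ ν₀ dom bgB hsc hd hκ hcr (fun _ _ hv => extd_mem_window hv) hA hB hdecA hdecB
    hs.C₅_nonneg hs.θ₅_pos.le hs.ω_nonneg hs.θ₅_le_ρ hs.ω_le_ρ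

end Produce

/-! ## §4 Faithfulness: in this currency def-B's β «ON THE MERGED TERM» is represented ON THE NOSE by a functional that STORES the limiting (1.21) kernel -/

section Faithful

variable {C : Carriers} {Bg : Type}
variable {𝔄 : Type*} [NormedRing 𝔄] [NormedAlgebra ℝ 𝔄] {V : Type*} [NormedAddCommGroup V] [NormedSpace ℝ V] {ι : Type*} [Fintype ι]

/-- **`RepresentsA` HOLDS BY CONSTRUCTION for def-B's `betaOfMerged (betaMerged F ℰ ρ bV) β0 γ`** (`Node00/BetaOfRecord`: on the box `β_{k+1}(v) = B12Beta.secondMoment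
(polLimit F (k+1) (ℰ k v ·) ρ bV) 0 1`, [I] (1.21)–(1.22)) and ANY run-A functional that STORES the limiting kernel `polLimit F (k+1) (ℰ k v ·) ρ bV μ ν z` at the carrier points
`(bg k μ ν z, dom k μ ν z)` along every box history (the DISPLAYED storage clause `hstore` — what a (D4)-faithful U3 reading must do), with the second-moment recipe at directions
`(0, 1)`.  Pure unfolding (`betaOfMerged_of_mem`). [bookkeeping] -/
theorem representsA_betaOfMerged_of_stores_polLimit (F₄ : T4Family) (ℰ : Node00.TermFamily1 F₄ 𝔄) (ρ : V →L[ℝ] 𝔄) (bV : Module.Basis ι ℝ V) (β0 : ℕ → ℝ) (γ : ℝ)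
    (E : Functional C Bg) (dom : ℕ → Fin 4 → Fin 4 → (Fin 4 → ℤ) → C.Dom) (bg : ℕ → Fin 4 → Fin 4 → (Fin 4 → ℤ) → Bg)
    (hstore : ∀ (k : ℕ) (v : Fin (k + 1) → ℝ), v ∈ Box γ k → ∀ (μ ν : Fin 4) (z : Fin 4 → ℤ),
      E (extd v) (bg k μ ν z) (dom k μ ν z) = Node00.polLimit F₄ (k + 1) (fun K => ℰ k v K) ρ bV μ ν z) :
    RepresentsA E (fun k F' => B12Beta.secondMoment (fun μ ν z => F' (bg k μ ν z) (dom k μ ν z)) 0 1) γ (Node00.betaOfMerged (Node00.betaMerged F₄ ℰ ρ bV) β0 γ) := by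
  intro k v hv
  rw [Node00.betaOfMerged_of_mem _ _ _ hv]
  show B12Beta.secondMoment _ 0 1 = B12Beta.secondMoment _ 0 1
  congr 1
  funext μ ν z
  exact (hstore k v hv μ ν z).symm

/-- **RUN-B TWIN**: `RepresentsB` for the same β and a run-B first-coupling family that stores, at step `k` and first coupling `w 0`, the limiting kernel of level `k + 2` at the
box history `w` (`β_{k+2}(w) = secondMoment (polLimit F (k+2) (ℰ (k+1) w ·) ρ bV) 0 1`; the re-indexing `extd (Fin.tail w)` is node U3's convention of `RepresentsB`).
Pure unfolding. [bookkeeping] -/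
theorem representsB_betaOfMerged_of_stores_polLimit (F₄ : T4Family) (ℰ : Node00.TermFamily1 F₄ 𝔄) (ρ : V →L[ℝ] 𝔄) (bV : Module.Basis ι ℝ V) (β0 : ℕ → ℝ) (γ : ℝ)
    (EB : ℝ → Functional C C.BgB) (dom : ℕ → Fin 4 → Fin 4 → (Fin 4 → ℤ) → C.Dom) (bgB : ℕ → Fin 4 → Fin 4 → (Fin 4 → ℤ) → C.BgB)
    (hstore : ∀ (k : ℕ) (w : Fin (k + 2) → ℝ), w ∈ Box γ (k + 1) → ∀ (μ ν : Fin 4) (z : Fin 4 → ℤ),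
      EB (w 0) (extd (Fin.tail w)) (bgB k μ ν z) (dom k μ ν z) = Node00.polLimit F₄ (k + 2) (fun K => ℰ (k + 1) w K) ρ bV μ ν z) :
    RepresentsB EB (fun k G => B12Beta.secondMoment (fun μ ν z => G (bgB k μ ν z) (dom k μ ν z)) 0 1) γ (Node00.betaOfMerged (Node00.betaMerged F₄ ℰ ρ bV) β0 γ) := by
  intro k w hw
  rw [Node00.betaOfMerged_of_mem _ _ _ hw]
  show B12Beta.secondMoment _ 0 1 = B12Beta.secondMoment _ 0 1
  congr 1
  funext μ ν z
  exact (hstore k w hw μ ν z).symm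

end Faithful

end Summit.QuantumFields.YangMills.BalabanUVNodes.N27ReadOutAtOfKernelSlices
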